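import Summits.ValiantsHypothesis.ValiantsHypothesis.Theorems.HartogsRankTwoFactorSideEasy
import Literature.Computability.AlgebraicComplexity.IMMInVPProofs

/-!
# ValiantsHypothesis / HartogsRankTwo — item `PivotChart` (stmt-ValiantsHypothesis-10336), closed

Pivoting on the minor `δ = x₀₀x₁₁ − x₀₁x₁₀`: with `U' = X_{·,{0,1}}` and `V'ᵀ = adj(X_{{0,1},{0,1}})·X_{{0,1},·}`
the polynomial `Q := per_{n+2}(U' V'ᵀ)` (the rank-two pullback of part `FactorSideEasy`, substituted)
has circuit size `poly(n)` and agrees with `δ^{n+2}·per_{n+2}` on the rank-`≤ 2` points `X = U Vᵀ`: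
there `U'V'ᵀ = U·V₀₁ᵀ·adj(V₀₁ᵀ)·adj(U₀₁)·U₀₁·Vᵀ = det(U₀₁) det(V₀₁)·U Vᵀ = δ(X)·X` identically in `U, V`
(no division, hence no density argument: `pivot_entry`), and `per(δ X) = δ^{n+2} per(X)`. The size
bound is `L(Q) ≤ L(per_{n+2}(U Vᵀ)) + Σ L(entries of U', V') ≤ 9(n+3)³ + 16(n+2)` by the substitution bound
`complexity_aeval_le` (Bürgisser 2000, Rem. 2.7). HONEST FRAMING: bookkeeping for a support item of a
dormant route; nothing here is progress on `VP ≠ VNP`.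
-/

-- layout Summits/ValiantsHypothesis/ValiantsHypothesis forces the duplicated namespace component
set_option linter.dupNamespace false

noncomputable section

namespace Summit.ValiantsHypothesis.ValiantsHypothesis.Theorems.HartogsRankTwo

open MvPolynomial Literature.Computability.AlgebraicComplexity

variable {n : ℕ}

/-- The pivot substitution: `U'_{(r,t)} = x_{r,t}` and `V'_{(i,t)} = (adj(X₀₁,₀₁) X_{01,·})_{t,i}`, written
with `+` and `C (-1) *` only (for the cost calculus). [folklore] -/
def pivotSubst (n : ℕ) : FSVars (n + 2) → MvPolynomial (Fin (n + 2) × Fin (n + 2)) ℂ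
  | Sum.inl (r, t) => ![X (r, 0), X (r, 1)] t
  | Sum.inr (i, t) =>
      ![X (1, 1) * X (0, i) + C (-1) * (X (0, 1) * X (1, i)),
        X (0, 0) * X (1, i) + C (-1) * (X (1, 0) * X (0, i))] t

/-- The chart polynomial `Q = per_{n+2}(U' V'ᵀ)`. [folklore] -/
def pivotChartPoly (n : ℕ) : MvPolynomial (Fin (n + 2) × Fin (n + 2)) ℂ :=
  bind₁ (pivotSubst n)
    (bind₁ (fun ij : Fin (n + 2) × Fin (n + 2) => ∑ t : Fin 2,
        (X (Sum.inl (ij.1, t)) * X (Sum.inr (ij.2, t)) : MvPolynomial (FSVars (n + 2)) ℂ))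
      (perPoly (Fin (n + 2)) ℂ))

/-- **The pivot identity on rank-`≤ 2` points**: at `X = U Vᵀ`,
`Σ_t U'_{(r,t)} V'_{(i,t)} = δ(X) · x_{r,i}`. [folklore] -/
theorem pivot_entry (U V : Fin (n + 2) → Fin 2 → ℂ) (r i : Fin (n + 2)) :
    ∑ t : Fin 2,
        eval (fun ij : Fin (n + 2) × Fin (n + 2) => ∑ s : Fin 2, U ij.1 s * V ij.2 s) (pivotSubst n (Sum.inl (r, t))) *
          eval (fun ij : Fin (n + 2) × Fin (n + 2) => ∑ s : Fin 2, U ij.1 s * V ij.2 s) (pivotSubst n (Sum.inr (i, t))) =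
      eval (fun ij : Fin (n + 2) × Fin (n + 2) => ∑ s : Fin 2, U ij.1 s * V ij.2 s)
          (X (0, 0) * X (1, 1) - X (0, 1) * X (1, 0)) *
        ∑ s : Fin 2, U r s * V i s := by
  simp only [Fin.sum_univ_two, pivotSubst, Matrix.cons_val_zero, Matrix.cons_val_one, map_add, map_mul,
    map_sub, eval_X, eval_C]
  ring

/-- Homogeneity of the permanent: `per(c·M) = c^m per(M)`. [folklore] -/
theorem eval_perPoly_smul {m : ℕ} (c : ℂ) (M : Fin m × Fin m → ℂ) :
    eval (fun ij => c * M ij) (perPoly (Fin m) ℂ) = c ^ m * eval M (perPoly (Fin m) ℂ) := by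
  rw [perPoly, Matrix.permanent]
  simp only [Matrix.mvPolynomialX_apply, map_sum, map_prod, eval_X, Finset.mul_sum]
  refine Finset.sum_congr rfl fun σ _ => ?_
  rw [Finset.prod_mul_distrib, Finset.prod_const, Finset.card_univ, Fintype.card_fin]

/-- **The chart agrees with `δ^{n+2} per_{n+2}` on rank-`≤ 2` points.** [folklore] -/
theorem eval_pivotChartPoly (U V : Fin (n + 2) → Fin 2 → ℂ) :
    eval (fun ij : Fin (n + 2) × Fin (n + 2) => ∑ t : Fin 2, U ij.1 t * V ij.2 t) (pivotChartPoly n) =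
      eval (fun ij : Fin (n + 2) × Fin (n + 2) => ∑ t : Fin 2, U ij.1 t * V ij.2 t)
        ((X (0, 0) * X (1, 1) - X (0, 1) * X (1, 0)) ^ (n + 2) * perPoly (Fin (n + 2)) ℂ) := by
  set M : Fin (n + 2) × Fin (n + 2) → ℂ := fun ij => ∑ t : Fin 2, U ij.1 t * V ij.2 t with hM
  rw [pivotChartPoly]
  change eval₂Hom (RingHom.id ℂ) M (bind₁ _ (bind₁ _ _)) = _
  rw [eval₂Hom_bind₁, eval₂Hom_bind₁]
  change eval (fun ij : Fin (n + 2) × Fin (n + 2) => eval (fun v => eval M (pivotSubst n v))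
      (∑ t : Fin 2, X (Sum.inl (ij.1, t)) * X (Sum.inr (ij.2, t)))) (perPoly (Fin (n + 2)) ℂ) = _
  have hpt : (fun ij : Fin (n + 2) × Fin (n + 2) => eval (fun v => eval M (pivotSubst n v))
      (∑ t : Fin 2, (X (Sum.inl (ij.1, t)) * X (Sum.inr (ij.2, t)) : MvPolynomial (FSVars (n + 2)) ℂ))) =
      fun ij => eval M (X (0, 0) * X (1, 1) - X (0, 1) * X (1, 0)) * M ij := by
    funext ij
    simp only [map_sum, map_mul, eval_X]
    rw [hM]
    exact pivot_entry U V ij.1 ij.2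
  rw [hpt, eval_perPoly_smul, map_mul, map_pow]

/-- Cost of the pivot substitution entries: at most `4` each. [folklore] -/
theorem complexity_pivotSubst_le (v : FSVars (n + 2)) : complexity (pivotSubst n v) ≤ 4 := by
  have hX := complexity_X_holds (k := ℂ) (σ := Fin (n + 2) × Fin (n + 2))
  have hC := complexity_C_holds (σ := Fin (n + 2) × Fin (n + 2)) (-1 : ℂ)
  have hquad : ∀ a b c d : Fin (n + 2) × Fin (n + 2),
      complexity (X a * X b + C (-1) * (X c * X d) : MvPolynomial (Fin (n + 2) × Fin (n + 2)) ℂ) ≤ 4 := by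
    intro a b c d
    have h1 := complexity_add_le_holds (X a * X b : MvPolynomial (Fin (n + 2) × Fin (n + 2)) ℂ)
      (C (-1) * (X c * X d))
    have h2 := complexity_mul_le_holds (X a : MvPolynomial (Fin (n + 2) × Fin (n + 2)) ℂ) (X b)
    have h3 := complexity_mul_le_holds (C (-1) : MvPolynomial (Fin (n + 2) × Fin (n + 2)) ℂ) (X c * X d)
    have h4 := complexity_mul_le_holds (X c : MvPolynomial (Fin (n + 2) × Fin (n + 2)) ℂ) (X d)
    have := hX a; have := hX b; have := hX c; have := hX d
    omega
  rcases v with ⟨r, t⟩ | ⟨i, t⟩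
  · fin_cases t
    · show complexity (X (r, 0) : MvPolynomial (Fin (n + 2) × Fin (n + 2)) ℂ) ≤ 4
      rw [hX]; exact Nat.zero_le _
    · show complexity (X (r, 1) : MvPolynomial (Fin (n + 2) × Fin (n + 2)) ℂ) ≤ 4
      rw [hX]; exact Nat.zero_le _
  · fin_cases t
    · exact hquad (1, 1) (0, i) (0, 1) (1, i)
    · exact hquad (0, 0) (1, i) (1, 0) (0, i)

/-- **Cost of the chart**: `L(Q) ≤ L(per_{n+2}(U Vᵀ)) + 16(n+2)`. [folklore] -/
theorem complexity_pivotChartPoly_le (n : ℕ) :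
    complexity (pivotChartPoly n) ≤
      ((n + 2 + 1) * (2 * ((n + 2 + 1) * ((n + 2) * 2 + (n + 2) + 1) + (n + 2 + 1)) + 2) + (n + 2 + 1)) +
        ((n + 2) * 2 * 4 + (n + 2) * 2 * 4) := by
  rw [pivotChartPoly, ← aeval_eq_bind₁]
  refine (complexity_aeval_le _ _).trans ?_
  have hT := complexity_rankTwoPer_le (n + 2)
  have hS : ∑ v : FSVars (n + 2), complexity (pivotSubst n v) ≤ (n + 2) * 2 * 4 + (n + 2) * 2 * 4 := by
    refine (Finset.sum_le_sum fun v _ => complexity_pivotSubst_le v).trans ?_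
    simp only [Finset.sum_const, Finset.card_univ, Fintype.card_sum, Fintype.card_prod, Fintype.card_fin,
      smul_eq_mul]
    omega
  exact Nat.add_le_add hT hS

/-- The cost bound in the form `n ^ c + c`, for every `c ≥ 700` (the exponent kept symbolic so that no
numeral power is ever evaluated). [folklore] -/
theorem complexity_pivotChartPoly_le_pow (c : ℕ) (hc : 700 ≤ c) (n : ℕ) :
    complexity (pivotChartPoly n) ≤ n ^ c + c := by
  refine (complexity_pivotChartPoly_le n).trans ?_
  have hB : (n + 2 + 1) * (2 * ((n + 2 + 1) * ((n + 2) * 2 + (n + 2) + 1) + (n + 2 + 1)) + 2) + (n + 2 + 1)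
      ≤ 9 * (n + 3) ^ 3 := by
    have h1 : (n + 2) * 2 + (n + 2) + 1 ≤ 3 * (n + 3) := by omega
    have h2 : (n + 2 + 1) * ((n + 2) * 2 + (n + 2) + 1) + (n + 2 + 1) ≤ 4 * (n + 3) ^ 2 := by nlinarith
    nlinarith [h2, Nat.zero_le n]
  refine (Nat.add_le_add_right hB _).trans ?_
  rcases Nat.lt_or_ge n 2 with h | h
  · have hsmall : 9 * (n + 3) ^ 3 + ((n + 2) * 2 * 4 + (n + 2) * 2 * 4) ≤ 700 := by
      interval_cases n <;> norm_num
    exact le_add_left (hsmall.trans hc)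
  · have ha : (n + 3) ^ 3 ≤ (3 * n) ^ 3 := Nat.pow_le_pow_left (by omega) 3
    have hb : (3 * n) ^ 3 = 27 * n ^ 3 := by ring
    have hc' : (n + 2) * 2 * 4 + (n + 2) * 2 * 4 ≤ 32 * n ^ 3 := by nlinarith
    have h3 : 9 * (n + 3) ^ 3 + ((n + 2) * 2 * 4 + (n + 2) * 2 * 4) ≤ 275 * n ^ 3 := by omega
    have h9 : 2 ^ 9 ≤ n ^ 9 := Nat.pow_le_pow_left h 9
    have h12 : 275 * n ^ 3 ≤ n ^ 12 := by
      calc 275 * n ^ 3 ≤ 2 ^ 9 * n ^ 3 := by omega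
        _ ≤ n ^ 9 * n ^ 3 := Nat.mul_le_mul_right _ h9
        _ = n ^ 12 := by ring
    have hpos : 0 < n := by omega
    have hexp : 12 ≤ c := by omega
    have hlast : n ^ 12 ≤ n ^ c + c := le_add_right (Nat.pow_le_pow_right hpos hexp)
    exact h3.trans (h12.trans hlast)

/-- **Item `PivotChart` (stmt-ValiantsHypothesis-10336).** [folklore] -/
theorem pivotChart_proof : Theses.HartogsRankTwo.PivotChart :=
  ⟨700, fun n => ⟨pivotChartPoly n, fun U V => eval_pivotChartPoly U V,
    complexity_pivotChartPoly_le_pow 700 le_rfl n⟩⟩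

end Summit.ValiantsHypothesis.ValiantsHypothesis.Theorems.HartogsRankTwo

end
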